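import Summits.Ventures.Crystal3D.Theorems.StickyWulffConstantTextureLiminfTexShadowCoverageBarlowSteer2WideDefs
import Summits.Ventures.Crystal3D.Theorems.StickyWulffConstantCoaxialWallLawTwinWord
import HarnessLib

/-!
# TexShadow row (e) / EDGE-ON: the TWIN RE-PRESENTATION of a Barlow plate and the REPRESENTED two-sided wide-steered menu
# (lane T, crux `TextureLiminfV5`, stmt-Ventures-23912, sub-crux EDGE-ON; cf-p1 DECISION (clxviii)(1)(a) 2026-08-29T08:23:14Z, 19480-p1 g15's corollary 08:22:30Z)

HONEST FRAMING. Venture `Summits/Ventures/Crystal3D` (cell `crystal3d-full`), route `route-Ventures-StickyWulffConstant`, helper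
`--supports` the law-v5 crux `TextureLiminfV5` (stmt-Ventures-23912), registered line `TexShadow` (v8.7 → v8.8 re-cut `stub_edgeOnRep`).
DEFINITIONS + elementary lattice identities; no certificate is asserted; rung F-C1 not moved.

THE POINT.  The two-sided wide-steered certificate `BarlowMenuSteer2WideCertified c₀ σ₁ σ₂ L₁ L₂` (p705084) launches each plate's steered family from
the three reference UP-slots `u_k` of its up-presentation; its launch-failure set is the STEEP corner `SteepPlateAt` (p706442/p707977).  A Barlow plate
`stacking L s σ` has a SECOND presentation with the same origin: the **twin re-presentation** `(twinRepFrame L, s, −σ)`, frame `L ∘ R` with `R = twinRot`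
the half-turn `(x, y, z) ↦ (−x, −y, z)` about the model axis (site `(k, i, j) ↦ (k, −i, −j)`, letter `ℓ ↦ −ℓ`: `stacking_twinRep`), whose reference
up-slots are the former capper directions `T_k = R u_k = −M u_k` (`twinRot_eq_neg_basalMirror`).  The six directions `{u_k} ∪ {T_k}` cover the closed
half-sphere at `60°` (19480-p1, `…SteepPlateTwin`), so at the chord of record NO plate is steep in both presentations.  This file types
* `twinRot`, `twinRepFrame L := twinRot.trans L`, the word lemmas `haggLabel_negWord`, `isHaggSeq_negWord`, the site lemma `twinRot_barlowPos`,
  **`stacking_twinRep : stacking (twinRepFrame L) s (fun n => -σ n) = stacking L s σ`**, and `twinRepFrame_symm_apply_two` (same hemisphere);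
* **`BarlowMenuSteer2WideRepCertified c₀ σ₁ σ₂ L₁ L₂`** := the p705084 menu certified in SOME of the four presentation pairs
  `(L₁ | twinRepFrame L₁) × (L₂ | twinRepFrame L₂)` (words `σ | −σ`); schema **`ResidualSteer2WideRepCoverageBarlowOn Reg c₀`**; inclusions.
The cell / cut glue (`bilayerWallAt_of_barlowMenuSteer2WideRepCertified`, `edgeOnS_of_repCut`) and the geometry `not_steepPlateAt_rep` are the companion
file `…CoverageBarlowSteer2WideRepGlue`.
WHAT THIS IS NOT: no certificate; pairs whose flux sum `rise₁ + rise₂ < √2·c₀` in all four presentation pairs, or whose chain frames read / fail to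
separate, stay uncertified; F-C1 not moved.
-/

noncomputable section

open scoped BigOperators InnerProductSpace ENNReal
open MeasureTheory Filter

namespace Summit.Ventures.Crystal3D.Cruxes.TextureLiminf.TexShadow

open Summit.Ventures.Crystal3D Summit.Ventures.Crystal3D.Theorems
open Literature.MathematicalPhysics.StatisticalMechanics (IsHaggSeq fccStacking barlowStacking barlowPos basalMirror haggLabel haggLabel_succ
  haggLabel_zero barlowPos_apply_zero barlowPos_apply_one barlowPos_apply_two basalMirror_apply_coord)

/-! ## The half-turn about the model axis -/

/-- **The half-turn `R` about the model stacking axis**: the reflection of `ℝ³` in the line `ℝ e₃`, `(x, y, z) ↦ (−x, −y, z)` (the `…CoaxialWallLawTwinWord`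
term, named). -/
def twinRot : E3 ≃ₗᵢ[ℝ] E3 :=
  (ℝ ∙ (EuclideanSpace.single (2 : Fin 3) (1 : ℝ) : E3)).reflection

/-- Coordinates of the half-turn: `(−p₀, −p₁, p₂)`. -/
theorem twinRot_coord (p : E3) : twinRot p 0 = -p 0 ∧ twinRot p 1 = -p 1 ∧ twinRot p 2 = p 2 :=
  halfTurn_coord p

/-- The half-turn is an involution. -/
theorem twinRot_twinRot (p : E3) : twinRot (twinRot p) = p :=
  Submodule.reflection_reflection _ p

/-- `R⁻¹ = R`. -/
theorem twinRot_symm_apply (p : E3) : twinRot.symm p = twinRot p :=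
  calc twinRot.symm p = twinRot.symm (twinRot (twinRot p)) := by rw [twinRot_twinRot]
    _ = twinRot p := twinRot.symm_apply_apply _

/-- **`R = −M` on `ℝ³`**: the half-turn is minus the basal mirror, `twinRot p = −basalMirror p` (so the twin presentation's up-slots `R u_k` are the
capper directions `−M u_k`). -/
theorem twinRot_eq_neg_basalMirror (p : E3) : twinRot p = -basalMirror p := by
  obtain ⟨h0, h1, h2⟩ := twinRot_coord p
  ext t
  fin_cases t
  · simp only [Fin.zero_eta, Fin.isValue] at h0 ⊢
    rw [h0, PiLp.neg_apply, basalMirror_apply_coord]; simp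
  · simp only [Fin.mk_one, Fin.isValue] at h1 ⊢
    rw [h1, PiLp.neg_apply, basalMirror_apply_coord]; simp
  · simp only [Fin.reduceFinMk, Fin.isValue] at h2 ⊢
    rw [h2, PiLp.neg_apply, basalMirror_apply_coord]; simp

/-- `R (M p) = −p`. -/
theorem twinRot_basalMirror (p : E3) : twinRot (basalMirror p) = -p := by
  rw [twinRot_eq_neg_basalMirror, Literature.MathematicalPhysics.StatisticalMechanics.basalMirror_basalMirror]

/-! ## The negated word -/

/-- **Labels of the negated word**: `haggLabel (−σ) k = −haggLabel σ k`. -/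
theorem haggLabel_negWord (σ : ℤ → ℤ) (k : ℤ) : haggLabel (fun n => -σ n) k = -haggLabel σ k := by
  induction k using Int.induction_on with
  | zero => simp
  | succ k ih => rw [haggLabel_succ, haggLabel_succ, ih]; ring
  | pred k ih =>
    have h₁ := haggLabel_succ (fun n => -σ n) (-(k : ℤ) - 1)
    have h₂ := haggLabel_succ σ (-(k : ℤ) - 1)
    rw [sub_add_cancel] at h₁ h₂
    linear_combination ih - h₁ - h₂

/-- The negated word of a Hägg word is a Hägg word. -/
theorem isHaggSeq_negWord {σ : ℤ → ℤ} (hσ : IsHaggSeq σ) : IsHaggSeq fun n => -σ n := by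
  intro n
  rcases hσ n with h | h <;> simp [h]

/-- Negating twice gives the word back. -/
theorem negWord_negWord (σ : ℤ → ℤ) : (fun n => -(fun m => -σ m) n) = σ :=
  funext fun n => neg_neg (σ n)

/-! ## The half-turn maps the `σ`-stacking onto the `(−σ)`-stacking -/

/-- **Site lemma**: `R (barlowPos σ k i j) = barlowPos (−σ) k (−i) (−j)`. -/
theorem twinRot_barlowPos (σ : ℤ → ℤ) (k i j : ℤ) :
    twinRot (barlowPos 1 (Real.sqrt (2 / 3)) σ k i j) = barlowPos 1 (Real.sqrt (2 / 3)) (fun n => -σ n) k (-i) (-j) := by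
  obtain ⟨h0, h1, h2⟩ := twinRot_coord (barlowPos 1 (Real.sqrt (2 / 3)) σ k i j)
  ext t
  fin_cases t
  · simp only [Fin.zero_eta, Fin.isValue] at h0 ⊢
    rw [h0, barlowPos_apply_zero, barlowPos_apply_zero, haggLabel_negWord]
    push_cast; ring
  · simp only [Fin.mk_one, Fin.isValue] at h1 ⊢
    rw [h1, barlowPos_apply_one, barlowPos_apply_one, haggLabel_negWord]
    push_cast; ring
  · simp only [Fin.reduceFinMk, Fin.isValue] at h2 ⊢
    rw [h2, barlowPos_apply_two, barlowPos_apply_two]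

/-- **The half-turn image of the `σ`-stacking is the `(−σ)`-stacking.** -/
theorem twinRot_image_barlowStacking (σ : ℤ → ℤ) :
    twinRot '' barlowStacking 1 (Real.sqrt (2 / 3)) σ = barlowStacking 1 (Real.sqrt (2 / 3)) (fun n => -σ n) := by
  ext x
  constructor
  · rintro ⟨p, ⟨k, i, j, rfl⟩, rfl⟩
    exact ⟨k, -i, -j, twinRot_barlowPos σ k i j⟩
  · rintro ⟨k, i, j, rfl⟩
    refine ⟨barlowPos 1 (Real.sqrt (2 / 3)) σ k (-i) (-j), ⟨k, -i, -j, rfl⟩, ?_⟩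
    rw [twinRot_barlowPos, neg_neg, neg_neg]

/-! ## The twin re-presentation of a plate -/

/-- **The twin re-presentation frame** `L ∘ R` of a frame `L` (`R = twinRot`): it presents the plate `stacking L s σ` with the SAME origin and the
negated word (`stacking_twinRep`), and its reference up-slots are `L` applied to the capper directions `−M u_k`. -/
def twinRepFrame (L : E3 ≃ₗᵢ[ℝ] E3) : E3 ≃ₗᵢ[ℝ] E3 :=
  twinRot.trans L

/-- Unfolding: `twinRepFrame L x = L (R x)`. -/
theorem twinRepFrame_apply (L : E3 ≃ₗᵢ[ℝ] E3) (x : E3) : twinRepFrame L x = L (twinRot x) := rfl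

/-- Re-presenting twice gives the frame back. -/
theorem twinRepFrame_twinRepFrame (L : E3 ≃ₗᵢ[ℝ] E3) : twinRepFrame (twinRepFrame L) = L := by
  ext x : 1
  rw [twinRepFrame_apply, twinRepFrame_apply, twinRot_twinRot]

/-- **Same plate, same origin**: `stacking (twinRepFrame L) s (−σ) = stacking L s σ`. -/
theorem stacking_twinRep (L : E3 ≃ₗᵢ[ℝ] E3) (s : E3) (σ : ℤ → ℤ) :
    stacking (twinRepFrame L) s (fun n => -σ n) = stacking L s σ := by
  have h : twinRot '' barlowStacking 1 (Real.sqrt (2 / 3)) (fun n => -σ n) = barlowStacking 1 (Real.sqrt (2 / 3)) σ := by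
    rw [twinRot_image_barlowStacking]; simp only [neg_neg]
  unfold stacking twinRepFrame
  rw [← h, Set.image_image]
  rfl

/-- The same, with the roles exchanged: `stacking (twinRepFrame L) s σ = stacking L s (−σ)`. -/
theorem stacking_twinRep' (L : E3 ≃ₗᵢ[ℝ] E3) (s : E3) (σ : ℤ → ℤ) :
    stacking (twinRepFrame L) s σ = stacking L s (fun n => -σ n) := by
  rw [← stacking_twinRep L s (fun n => -σ n), negWord_negWord]

/-- **Same hemisphere**: the pulled-back axis has the same third coordinate, `((twinRepFrame L)⁻¹ e)₂ = (L⁻¹ e)₂`. -/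
theorem twinRepFrame_symm_apply_two (L : E3 ≃ₗᵢ[ℝ] E3) (e : E3) : ((twinRepFrame L).symm e) 2 = (L.symm e) 2 := by
  unfold twinRepFrame
  rw [LinearIsometryEquiv.symm_trans, LinearIsometryEquiv.trans_apply, twinRot_symm_apply]
  exact (twinRot_coord _).2.2

/-- The twin re-presentation fixes the image of the model axis: `twinRepFrame L e₃ = L e₃`. -/
theorem twinRepFrame_e₃ (L : E3 ≃ₗᵢ[ℝ] E3) : twinRepFrame L e₃ = L e₃ := by
  rw [twinRepFrame_apply]
  exact congrArg L halfTurn_e₃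

/-- **Up-presentations correspond**: `upFrame (twinRepFrame L) e v = −(upFrame L e) (M v)` — the reference up-slots of the twin re-presentation,
read toward `e`, are the capper directions of the original up-presentation. -/
theorem upFrame_twinRepFrame_apply (L : E3 ≃ₗᵢ[ℝ] E3) (e v : E3) :
    upFrame (twinRepFrame L) e v = -(upFrame L e (basalMirror v)) := by
  unfold upFrame
  rw [twinRepFrame_symm_apply_two]
  split_ifs
  · rw [twinRepFrame_apply, ← map_neg, ← twinRot_basalMirror, Literature.MathematicalPhysics.StatisticalMechanics.basalMirror_basalMirror]
  · rw [LinearIsometryEquiv.trans_apply, LinearIsometryEquiv.trans_apply, twinRepFrame_apply, twinRot_basalMirror, map_neg,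
      Literature.MathematicalPhysics.StatisticalMechanics.basalMirror_basalMirror]

/-! ## The represented two-sided wide-steered menu -/

/-- **Certified over the TWO-SIDED WIDE-STEERED menu in SOME presentation pair**: the p705084 menu `BarlowMenuSteer2WideCertified c₀` holds for
`(σ₁, σ₂, L₁, L₂)`, or with plate 1 re-presented `(−σ₁, twinRepFrame L₁)`, or with plate 2 re-presented, or with both. -/
def BarlowMenuSteer2WideRepCertified (c₀ : ℝ) (σ₁ σ₂ : ℤ → ℤ) (L₁ L₂ : E3 ≃ₗᵢ[ℝ] E3) : Prop :=
  BarlowMenuSteer2WideCertified c₀ σ₁ σ₂ L₁ L₂ ∨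
    BarlowMenuSteer2WideCertified c₀ (fun n => -σ₁ n) σ₂ (twinRepFrame L₁) L₂ ∨
    BarlowMenuSteer2WideCertified c₀ σ₁ (fun n => -σ₂ n) L₁ (twinRepFrame L₂) ∨
    BarlowMenuSteer2WideCertified c₀ (fun n => -σ₁ n) (fun n => -σ₂ n) (twinRepFrame L₁) (twinRepFrame L₂)

/-- A menu-certified pair is represented-menu certified (first presentation pair). -/
theorem steer2WideRepCertified_of_steer2WideCertified {c₀ : ℝ} {σ₁ σ₂ : ℤ → ℤ} {L₁ L₂ : E3 ≃ₗᵢ[ℝ] E3}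
    (h : BarlowMenuSteer2WideCertified c₀ σ₁ σ₂ L₁ L₂) : BarlowMenuSteer2WideRepCertified c₀ σ₁ σ₂ L₁ L₂ :=
  Or.inl h

/-! ## The certificate schema -/

/-- **THE BARLOW COVERAGE CERTIFICATE ON `Reg`, REPRESENTED TWO-SIDED WIDE-STEERED MENU** (schema). -/
def ResidualSteer2WideRepCoverageBarlowOn (Reg : (ℤ → ℤ) → (ℤ → ℤ) → (E3 ≃ₗᵢ[ℝ] E3) → (E3 ≃ₗᵢ[ℝ] E3) → Prop) (c₀ : ℝ) : Prop :=
  ∀ (σ₁ σ₂ : ℤ → ℤ), IsHaggSeq σ₁ → IsHaggSeq σ₂ → ¬ BothFcc σ₁ σ₂ →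
    ∀ (L₁ L₂ : E3 ≃ₗᵢ[ℝ] E3), Reg σ₁ σ₂ L₁ L₂ → BarlowMenuSteer2WideRepCertified c₀ σ₁ σ₂ L₁ L₂

/-! ## Inclusions -/

/-- A two-sided-menu certificate is a represented one. -/
theorem steer2WideRepCoverageBarlowOn_of_steer2WideCoverageBarlowOn {Reg : (ℤ → ℤ) → (ℤ → ℤ) → (E3 ≃ₗᵢ[ℝ] E3) → (E3 ≃ₗᵢ[ℝ] E3) → Prop}
    {c₀ : ℝ} (h : ResidualSteer2WideCoverageBarlowOn Reg c₀) : ResidualSteer2WideRepCoverageBarlowOn Reg c₀ :=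
  fun σ₁ σ₂ hσ₁ hσ₂ hf L₁ L₂ hreg => Or.inl (h σ₁ σ₂ hσ₁ hσ₂ hf L₁ L₂ hreg)

/-- A menu certificate is a represented two-sided-menu certificate. -/
theorem steer2WideRepCoverageBarlowOn_of_menuCoverageBarlowOn {Reg : (ℤ → ℤ) → (ℤ → ℤ) → (E3 ≃ₗᵢ[ℝ] E3) → (E3 ≃ₗᵢ[ℝ] E3) → Prop} {c₀ : ℝ}
    (h : ResidualMenuCoverageBarlowOn Reg c₀) : ResidualSteer2WideRepCoverageBarlowOn Reg c₀ :=
  steer2WideRepCoverageBarlowOn_of_steer2WideCoverageBarlowOn (steer2WideCoverageBarlowOn_of_menuCoverageBarlowOn h)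

/-- Represented certificates restrict along implications of regimes. -/
theorem steer2WideRepCoverageBarlowOn_mono {Reg Reg' : (ℤ → ℤ) → (ℤ → ℤ) → (E3 ≃ₗᵢ[ℝ] E3) → (E3 ≃ₗᵢ[ℝ] E3) → Prop}
    (hle : ∀ σ₁ σ₂ L₁ L₂, Reg' σ₁ σ₂ L₁ L₂ → Reg σ₁ σ₂ L₁ L₂) {c₀ : ℝ} (h : ResidualSteer2WideRepCoverageBarlowOn Reg c₀) :
    ResidualSteer2WideRepCoverageBarlowOn Reg' c₀ :=
  fun σ₁ σ₂ hσ₁ hσ₂ hf L₁ L₂ hreg => h σ₁ σ₂ hσ₁ hσ₂ hf L₁ L₂ (hle σ₁ σ₂ L₁ L₂ hreg)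

/-- **The identity certificate, represented menu**: on the regime «represented-menu certified» every pair is certified. -/
theorem steer2WideRepCoverageBarlowOn_certified (c₀ : ℝ) :
    ResidualSteer2WideRepCoverageBarlowOn (BarlowMenuSteer2WideRepCertified c₀) c₀ :=
  fun _ _ _ _ _ _ _ h => h

end Summit.Ventures.Crystal3D.Cruxes.TextureLiminf.TexShadow

end
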